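import Mathlib
import HarnessLib
import Literature.Analysis.FluidPDE.ClassicalSolutionRegion

/-!
# Crux `PoloidalWindowRigidity` (K2, stmt-NavierStokesRegularity-19708) — STRATUM (A): the TYPED statement of THEOREM A
# (memo `Cruxes/PoloidalWindowRigidity/STRATUM-A-K2p4.md` v9, seat ns-poloidal-K2-p4 g2; DIRECTOR-NS #83 (3))

This crux workfile TYPES — it does not kernel-prove — the statement proved on paper (with machine-checked algebra, kit j294985 … verifyH)
in `STRATUM-A-K2p4.md` §0–§15:

**THEOREM A (thick part, local form).** `hempty_thick` (K2-p5 p579093, the u-only local emptiness statement of the THICK column: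
`…LocalThickOfLocalEmpty.stub_localThickTH_of_localEmptyThick`'s hypothesis) HOLDS on stratum (A), i.e. when one adds the single
hypothesis that the vorticity is invariant under the horizontal translation `e₀`:  `∀ p ∈ U, ∂₀(curl u(p.1))(p.2) = 0`.
The binders below are `hempty_thick`'s VERBATIM (div, poloidality, frozen law, pressure-free vorticity law, pins at `p₀` incl. THICKNESS),
plus that one line; the conclusion is `False`.  So `StratumA_NoThickTwistingGerm` is literally «`hempty_thick` restricted to stratum (A)».

**THEOREM A (TH part).** The twin `StratumA_NoTHTwistingGerm`: same binders with THICKNESS replaced by the (TH)∩{Λ_z ≠ 0} pins of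
K2-p3's `hempty` (slope a function of `(t, y₂)` near `p₀` with non-zero z-derivative) — also proved in the memo (§15).

Both `theorem`s below are `sorry`: the proof is the 16-section classification of the memo (velocity framework in vortex-line coordinates,
finite-type classification, ξ-Taylor chain, Case 3a over ℝ) and has NOT been ported to the kernel.  The memo is attached as evidence on the
crux item.  WHAT THIS IS NOT: not a kernel theorem, not a proof of `hempty_thick`, not Navier–Stokes regularity — a typed paper result about ONE
symmetric stratum of local germs, filed so that refuters can attack the exact binders.
-/

noncomputable section

set_option linter.dupNamespace false

namespace Summit.NavierStokesRegularity.NavierStokesRegularity.Cruxes.PoloidalWindowRigidity.StratumA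

open Set Function
open scoped RealInnerProductSpace InnerProductSpace Laplacian

/-- **THEOREM A, thick part (paper; memo STRATUM-A-K2p4.md §14): `hempty_thick` restricted to stratum (A).**  VERBATIM the binders of
`hempty_thick` (K2-p5 p579093) plus `hsymm : ∀ p ∈ U, ∂₀ (curl (u p.1)) p.2 = 0` (vorticity invariant under the horizontal translation `e₀`;
by a horizontal rotation this covers every horizontal direction).  Conclusion `False`: no such germ is THICK at a non-degenerate twisting point. -/
def StratumA_NoThickTwistingGerm : Prop :=
  ∀ (u : ℝ → EuclideanSpace ℝ (Fin 3) → EuclideanSpace ℝ (Fin 3))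
    (U : Set (ℝ × EuclideanSpace ℝ (Fin 3))) (p₀ : ℝ × EuclideanSpace ℝ (Fin 3)),
    IsOpen U → p₀ ∈ U →
    AnalyticOnNhd ℝ (Function.uncurry u) U →
    (∀ p ∈ U, fderiv ℝ (u p.1) p.2 (EuclideanSpace.single 0 1) 0 + fderiv ℝ (u p.1) p.2 (EuclideanSpace.single 1 1) 1 +
      fderiv ℝ (u p.1) p.2 (EuclideanSpace.single 2 1) 2 = 0) →
    (∀ p ∈ U, fderiv ℝ (u p.1) p.2 (EuclideanSpace.single 0 1) 1 = fderiv ℝ (u p.1) p.2 (EuclideanSpace.single 1 1) 0) →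
    (∀ p ∈ U, fderiv ℝ (u p.1) p.2 (EuclideanSpace.single 2 1) 0 * fderiv ℝ (u p.1) p.2 (EuclideanSpace.single 1 1) 2 -
      fderiv ℝ (u p.1) p.2 (EuclideanSpace.single 2 1) 1 * fderiv ℝ (u p.1) p.2 (EuclideanSpace.single 0 1) 2 = 0) →
    (∀ p ∈ U, ∀ j k : Fin 3,
      fderiv ℝ (fun y => deriv (fun s => u s y k) p.1 + fderiv ℝ (fun y' => u p.1 y' k) y (u p.1 y) -
          (Δ (fun y' => u p.1 y' k)) y) p.2 (EuclideanSpace.single j 1) =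
        fderiv ℝ (fun y => deriv (fun s => u s y j) p.1 + fderiv ℝ (fun y' => u p.1 y' j) y (u p.1 y) -
          (Δ (fun y' => u p.1 y' j)) y) p.2 (EuclideanSpace.single k 1)) →
    -- STRATUM (A): the vorticity is invariant under the horizontal translation e₀
    (∀ p ∈ U, fderiv ℝ (fun y => Literature.Analysis.FluidPDE.curl (u p.1) y) p.2 (EuclideanSpace.single 0 1) = 0) →
    fderiv ℝ (fun y => fderiv ℝ (u p₀.1) y (EuclideanSpace.single 2 1) 2) p₀.2 (EuclideanSpace.single 0 1) *
          fderiv ℝ (u p₀.1) p₀.2 (EuclideanSpace.single 1 1) 2 -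
        fderiv ℝ (fun y => fderiv ℝ (u p₀.1) y (EuclideanSpace.single 2 1) 2) p₀.2 (EuclideanSpace.single 1 1) *
          fderiv ℝ (u p₀.1) p₀.2 (EuclideanSpace.single 0 1) 2 ≠ 0 →
    (fderiv ℝ (u p₀.1) p₀.2 (EuclideanSpace.single 0 1) 2 ≠ 0 ∨ fderiv ℝ (u p₀.1) p₀.2 (EuclideanSpace.single 1 1) 2 ≠ 0) →
    (fderiv ℝ (u p₀.1) p₀.2 (EuclideanSpace.single 2 1) 0 ≠ 0 ∨ fderiv ℝ (u p₀.1) p₀.2 (EuclideanSpace.single 2 1) 1 ≠ 0) →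
    Literature.Analysis.FluidPDE.curl (u p₀.1) p₀.2 ≠ 0 →
    (fderiv ℝ (fun y =>
          (fderiv ℝ (u p₀.1) y (EuclideanSpace.single 2 1) 0 * fderiv ℝ (u p₀.1) y (EuclideanSpace.single 0 1) 2 +
              fderiv ℝ (u p₀.1) y (EuclideanSpace.single 2 1) 1 * fderiv ℝ (u p₀.1) y (EuclideanSpace.single 1 1) 2) /
            (fderiv ℝ (u p₀.1) y (EuclideanSpace.single 0 1) 2 ^ 2 + fderiv ℝ (u p₀.1) y (EuclideanSpace.single 1 1) 2 ^ 2))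
          p₀.2 (EuclideanSpace.single 0 1) ≠ 0 ∨
      fderiv ℝ (fun y =>
          (fderiv ℝ (u p₀.1) y (EuclideanSpace.single 2 1) 0 * fderiv ℝ (u p₀.1) y (EuclideanSpace.single 0 1) 2 +
              fderiv ℝ (u p₀.1) y (EuclideanSpace.single 2 1) 1 * fderiv ℝ (u p₀.1) y (EuclideanSpace.single 1 1) 2) /
            (fderiv ℝ (u p₀.1) y (EuclideanSpace.single 0 1) 2 ^ 2 + fderiv ℝ (u p₀.1) y (EuclideanSpace.single 1 1) 2 ^ 2))
          p₀.2 (EuclideanSpace.single 1 1) ≠ 0) →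
    False

/-- **THEOREM A, (TH) part (paper; memo §15).**  Same binders, with THICKNESS replaced by the (TH)∩{Λ_z ≠ 0} pin: the slope is a function
`m (t, y₂)` of time and height on `U` whose z-derivative at `p₀` is non-zero.  Conclusion `False`: stratum (A) carries no such germ either
(its only non-degenerate twisting germs have slope depending on `t` alone). -/
def StratumA_NoTHTwistingGerm : Prop :=
  ∀ (u : ℝ → EuclideanSpace ℝ (Fin 3) → EuclideanSpace ℝ (Fin 3))
    (U : Set (ℝ × EuclideanSpace ℝ (Fin 3))) (p₀ : ℝ × EuclideanSpace ℝ (Fin 3)) (m : ℝ → ℝ → ℝ),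
    IsOpen U → p₀ ∈ U →
    AnalyticOnNhd ℝ (Function.uncurry u) U →
    (∀ p ∈ U, fderiv ℝ (u p.1) p.2 (EuclideanSpace.single 0 1) 0 + fderiv ℝ (u p.1) p.2 (EuclideanSpace.single 1 1) 1 +
      fderiv ℝ (u p.1) p.2 (EuclideanSpace.single 2 1) 2 = 0) →
    (∀ p ∈ U, fderiv ℝ (u p.1) p.2 (EuclideanSpace.single 0 1) 1 = fderiv ℝ (u p.1) p.2 (EuclideanSpace.single 1 1) 0) →
    (∀ p ∈ U, ∀ j k : Fin 3,
      fderiv ℝ (fun y => deriv (fun s => u s y k) p.1 + fderiv ℝ (fun y' => u p.1 y' k) y (u p.1 y) -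
          (Δ (fun y' => u p.1 y' k)) y) p.2 (EuclideanSpace.single j 1) =
        fderiv ℝ (fun y => deriv (fun s => u s y j) p.1 + fderiv ℝ (fun y' => u p.1 y' j) y (u p.1 y) -
          (Δ (fun y' => u p.1 y' j)) y) p.2 (EuclideanSpace.single k 1)) →
    -- (TH): ∂₂u_b = m(t, y₂) ∂_b u₂ on U (b = 0,1), with ∂_z m ≠ 0 at p₀
    (∀ p ∈ U, ∀ b : Fin 3, b ≠ 2 →
      fderiv ℝ (u p.1) p.2 (EuclideanSpace.single 2 1) b = m p.1 (p.2 2) * fderiv ℝ (u p.1) p.2 (EuclideanSpace.single b 1) 2) →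
    deriv (m p₀.1) (p₀.2 2) ≠ 0 →
    -- STRATUM (A)
    (∀ p ∈ U, fderiv ℝ (fun y => Literature.Analysis.FluidPDE.curl (u p.1) y) p.2 (EuclideanSpace.single 0 1) = 0) →
    fderiv ℝ (fun y => fderiv ℝ (u p₀.1) y (EuclideanSpace.single 2 1) 2) p₀.2 (EuclideanSpace.single 0 1) *
          fderiv ℝ (u p₀.1) p₀.2 (EuclideanSpace.single 1 1) 2 -
        fderiv ℝ (fun y => fderiv ℝ (u p₀.1) y (EuclideanSpace.single 2 1) 2) p₀.2 (EuclideanSpace.single 1 1) *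
          fderiv ℝ (u p₀.1) p₀.2 (EuclideanSpace.single 0 1) 2 ≠ 0 →
    (fderiv ℝ (u p₀.1) p₀.2 (EuclideanSpace.single 0 1) 2 ≠ 0 ∨ fderiv ℝ (u p₀.1) p₀.2 (EuclideanSpace.single 1 1) 2 ≠ 0) →
    (fderiv ℝ (u p₀.1) p₀.2 (EuclideanSpace.single 2 1) 0 ≠ 0 ∨ fderiv ℝ (u p₀.1) p₀.2 (EuclideanSpace.single 2 1) 1 ≠ 0) →
    Literature.Analysis.FluidPDE.curl (u p₀.1) p₀.2 ≠ 0 →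
    False

/-- THEOREM A, thick part — PAPER PROOF ONLY (memo STRATUM-A-K2p4.md §0–§14; machine algebra kit j294985…); not ported to the kernel. -/
theorem stratumA_noThickTwistingGerm : StratumA_NoThickTwistingGerm := by
  sorry

/-- THEOREM A, (TH) part — PAPER PROOF ONLY (memo §3, §7, §15); not ported to the kernel. -/
theorem stratumA_noTHTwistingGerm : StratumA_NoTHTwistingGerm := by
  sorry

end Summit.NavierStokesRegularity.NavierStokesRegularity.Cruxes.PoloidalWindowRigidity.StratumA

end
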